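import Mathlib

/-!
# Field-side toolkit for route (D′), part 2: squares generate, pieces stable under `ι(k)`
# (crux `LevelGradedCohnUmans.GradedDesignFamily`, stmt-MatrixMultiplication-7610; negative side,
# line `quadratic-extension-level-one-cell`, unit b2b-lgcu-subfield gen 18)

HONEST FRAMING.  Support lemmas for route (D′) of the cell doc (SUBFIELD.md §23.6), resolving its
caveat that the abstract hom `φ : SL₂(k) →* GL₂(K)` need not be `k`-linear: the additive parameter
set `A` of the root group `φ(u(k))` is stable under the SQUARES of the torus eigenvalues, and

* `finiteField_exists_sq_add_sq` — every element of a finite field is a sum of two squares;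
* `mul_mem_of_sq_mul_mem` — hence an additively closed piece `A ⊆ K` stable under `ι(a)² · _`
  for all `a : k` is stable under `ι(k) · _`;
* `eq_image_mul_of_card_eq` — and if moreover `|A| = |k|`, `λ ∈ A`, `λ ≠ 0`, then `A = ι(k)·λ`;
* `image_units_eq_of_injective` — an injective hom `θ : kˣ →* Kˣ` has the same image as `ι` on `kˣ`
  (both are the roots of `X ^ (|k|-1) - 1`).

NOT summit progress.  Sorry-free. [folklore]
-/

set_option linter.dupNamespace false

open Polynomial

namespace Summit.MatrixMultiplication.MatrixMultiplication.Theorems.GradedDesignFamily.Negative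

variable {k K : Type} [Field k] [Fintype k] [Field K]

omit [Field K] in
/-- Every element of a finite field is a sum of two squares. [folklore] -/
theorem finiteField_exists_sq_add_sq (x : k) : ∃ a b : k, a ^ 2 + b ^ 2 = x := by
  classical
  by_cases h2 : ringChar k = 2
  · obtain ⟨a, ha⟩ := FiniteField.isSquare_of_char_two h2 x
    exact ⟨a, 0, by rw [ha]; ring⟩
  · have hodd : Fintype.card k % 2 = 1 := by
      rcases Nat.mod_two_eq_zero_or_one (Fintype.card k) with h | h
      · exact absurd (FiniteField.even_card_iff_char_two.mpr h) h2
      · exact h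
    obtain ⟨a, b, hab⟩ : ∃ a b, (X ^ 2 : k[X]).eval a + (X ^ 2 - C x : k[X]).eval b = 0 :=
      FiniteField.exists_root_sum_quadratic (degree_X_pow 2) (degree_X_pow_sub_C (by decide) _)
        hodd
    refine ⟨a, b, ?_⟩
    rw [← sub_eq_zero]
    simpa only [eval_C, eval_X, eval_pow, eval_sub, ← add_sub_assoc] using hab

/-- **(F4)** An additively closed piece `A ⊆ K` stable under multiplication by the squares `ι(a)²`,
`a : k`, is stable under multiplication by all of `ι(k)`. [folklore] -/
theorem mul_mem_of_sq_mul_mem (ι : k →+* K) (A : Finset K)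
    (hadd : ∀ x ∈ A, ∀ y ∈ A, x + y ∈ A) (hsq : ∀ a : k, ∀ x ∈ A, ι a ^ 2 * x ∈ A) (b : k) :
    ∀ x ∈ A, ι b * x ∈ A := by
  intro x hx
  obtain ⟨a₁, a₂, h⟩ := finiteField_exists_sq_add_sq b
  rw [← h, map_add, map_pow, map_pow, add_mul]
  exact hadd _ (hsq a₁ x hx) _ (hsq a₂ x hx)

/-- **(F5)** If `A` is stable under `ι(k) · _`, has `|A| = |k|` and contains `λ ≠ 0`, then
`A = ι(k)·λ` is an `ι(k)`-line. [folklore] -/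
theorem eq_image_mul_of_card_eq [DecidableEq K] (ι : k →+* K) (A : Finset K) {l : K} (hl : l ∈ A)
    (hl0 : l ≠ 0) (hmul : ∀ b : k, ∀ x ∈ A, ι b * x ∈ A) (hcard : A.card = Fintype.card k) :
    A = Finset.univ.image (fun b : k => ι b * l) := by
  symm
  apply Finset.eq_of_subset_of_card_le
  · intro y hy
    obtain ⟨b, -, rfl⟩ := Finset.mem_image.mp hy
    exact hmul b l hl
  · rw [hcard, Finset.card_image_of_injective _ ?_, Finset.card_univ]
    intro b b' h
    exact ι.injective (mul_right_cancel₀ hl0 h)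

/-- **(F6)** An injective hom `θ : kˣ →* Kˣ` has the same image as `ι : k →+* K` on `kˣ`: both
images consist of roots of `X ^ (|k| - 1) - 1`, of which `K` has at most `|k| - 1`. [folklore] -/
theorem image_units_eq_of_injective [DecidableEq k] [DecidableEq K] (ι : k →+* K) (θ : kˣ →* Kˣ)
    (hθ : Function.Injective θ) :
    Finset.univ.image (fun a : kˣ => ((θ a : Kˣ) : K)) =
      Finset.univ.image (fun a : kˣ => ι (a : k)) := by
  classical
  have hnpos : 0 < Fintype.card k - 1 := by
    have := Fintype.one_lt_card (α := k)
    omega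
  -- both images lie in the root set of `X ^ (|k| - 1) - 1`, which has at most `|k| - 1` elements
  have hRcard : (nthRootsFinset (Fintype.card k - 1) (1 : K)).card ≤ Fintype.card k - 1 := by
    rw [nthRootsFinset_def]
    exact (Multiset.toFinset_card_le _).trans (card_nthRoots _ _)
  have hθsub : Finset.univ.image (fun a : kˣ => ((θ a : Kˣ) : K)) ⊆
      nthRootsFinset (Fintype.card k - 1) (1 : K) := by
    intro x hx
    obtain ⟨a, -, rfl⟩ := Finset.mem_image.mp hx
    rw [mem_nthRootsFinset hnpos, ← Units.val_pow_eq_pow_val, ← map_pow, ← Fintype.card_units,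
      pow_card_eq_one, map_one, Units.val_one]
  have hιsub : Finset.univ.image (fun a : kˣ => ι (a : k)) ⊆
      nthRootsFinset (Fintype.card k - 1) (1 : K) := by
    intro x hx
    obtain ⟨a, -, rfl⟩ := Finset.mem_image.mp hx
    rw [mem_nthRootsFinset hnpos, ← map_pow, FiniteField.pow_card_sub_one_eq_one (a : k) a.ne_zero,
      map_one]
  have hθinj : Function.Injective (fun a : kˣ => ((θ a : Kˣ) : K)) :=
    fun a b h => hθ (Units.val_injective h)
  have hιinj : Function.Injective (fun a : kˣ => ι (a : k)) :=
    fun a b h => Units.val_injective (ι.injective h)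
  have hθcard : (Finset.univ.image (fun a : kˣ => ((θ a : Kˣ) : K))).card = Fintype.card k - 1 := by
    rw [Finset.card_image_of_injective _ hθinj, Finset.card_univ, Fintype.card_units]
  have hιcard : (Finset.univ.image (fun a : kˣ => ι (a : k))).card = Fintype.card k - 1 := by
    rw [Finset.card_image_of_injective _ hιinj, Finset.card_univ, Fintype.card_units]
  rw [Finset.eq_of_subset_of_card_le hθsub (by rw [hθcard]; exact hRcard),
    Finset.eq_of_subset_of_card_le hιsub (by rw [hιcard]; exact hRcard)]

end Summit.MatrixMultiplication.MatrixMultiplication.Theorems.GradedDesignFamily.Negative
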